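import Summits.CriticalPhenomena.CardyFormulaZ2.Theses.CardyBoundaryCoulombGas
import Mathlib.Topology.Algebra.InfiniteSum.Order
import Mathlib.Topology.Algebra.InfiniteSum.Ring

/-!
# The Bethe scattering kernel is positive semidefinite
(line `two-cluster-rate-is-stationary-gap`, crux `StripClusterRates`)

`G'(x) = (√3/2)/(cosh 2x + 1/2)` is the derivative of the Bethe scattering phase
`arctan(tanh x/√3)` of the ground-state Bethe equations of the open staggered TL(1) chain at
`γ = π/3`. Its positive-semidefiniteness (Bochner: `Ĝ'(ω) = π/(1 + 2 cosh(πω/3)) > 0`) is the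
structural fact behind convexity of the Yang–Yang action, hence uniqueness and condensation of the
Bethe roots, used by the Bethe-asymptotics pillar BA₁.

This file proves the registered helper `bu_kernel_posSemidef` (H-d), the ASSEMBLY step: it takes
as explicit hypotheses

* H-d1 (`bu_kernel_partialFraction`): the Mittag-Leffler expansion of `G'` into paired
  Lorentzians `T_n(x) = a_n/(x² + a_n²) - b_n/(x² + b_n²)`, `a_n = π/3 + πn`, `b_n = 2π/3 + πn`;
* H-d2 (`bu_lorentzPair_posSemidef`): every paired Lorentzian with `0 < a ≤ b` is a
  positive-semidefinite kernel;

and concludes `0 ≤ Σ_{j,l} G'(p_j - p_l) y_j y_l` for all `M`, `p y : Fin M → ℝ`.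

## Proof

Multiply the series of H-d1 at `x := p_j - p_l` by `y_j y_l` (`HasSum.mul_right`) and sum over the
finite index set (`hasSum_sum` twice): the quadratic form of `G'` is the sum of the series whose
`n`-th term is the quadratic form of `T_n`, which is `≥ 0` by H-d2 (`0 < π/3 + πn ≤ 2π/3 + πn`).
A convergent series of nonnegative terms has a nonnegative sum (`HasSum.nonneg`).
-/

noncomputable section

namespace Summit.CriticalPhenomena.CardyFormulaZ2.Cruxes.StripClusterRates.TwoClusterRateIsStationaryGap

/-- **H-d · the Bethe scattering kernel `G'(x) = (√3/2)/(cosh 2x + 1/2)` is positive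
semidefinite**, assembled from the partial-fraction expansion of `G'` into paired Lorentzians
(hypothesis 1, `bu_kernel_partialFraction`) and positive-semidefiniteness of each paired
Lorentzian (hypothesis 2, `bu_lorentzPair_posSemidef`): a convergent sum of positive-semidefinite
kernels is positive semidefinite (`hasSum_sum`, `HasSum.nonneg`). [folklore] -/
theorem bu_kernel_posSemidef : (∀ x : ℝ, HasSum (fun n : ℕ ↦ (Real.pi / 3 + Real.pi * n) / (x ^ 2 + (Real.pi / 3 + Real.pi * n) ^ 2) - (2 * Real.pi / 3 + Real.pi * n) / (x ^ 2 + (2 * Real.pi / 3 + Real.pi * n) ^ 2)) (Real.sqrt 3 / 2 / (Real.cosh (2 * x) + 1 / 2))) → (∀ a b : ℝ, 0 < a → a ≤ b → ∀ (M : ℕ) (p y : Fin M → ℝ), 0 ≤ ∑ j, ∑ l, (a / ((p j - p l) ^ 2 + a ^ 2) - b / ((p j - p l) ^ 2 + b ^ 2)) * y j * y l) → ∀ (M : ℕ) (p y : Fin M → ℝ), 0 ≤ ∑ j, ∑ l, Real.sqrt 3 / 2 / (Real.cosh (2 * (p j - p l)) + 1 / 2) * y j * y l := by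
  intro h1 h2 M p y
  -- the quadratic form of `G'` is the sum of the series of the quadratic forms of the `T_n`
  have hS : HasSum (fun n : ℕ => ∑ j, ∑ l,
      ((Real.pi / 3 + Real.pi * n) / ((p j - p l) ^ 2 + (Real.pi / 3 + Real.pi * n) ^ 2) -
        (2 * Real.pi / 3 + Real.pi * n) / ((p j - p l) ^ 2 + (2 * Real.pi / 3 + Real.pi * n) ^ 2)) *
        y j * y l)
      (∑ j, ∑ l, Real.sqrt 3 / 2 / (Real.cosh (2 * (p j - p l)) + 1 / 2) * y j * y l) :=
    hasSum_sum fun j _ => hasSum_sum fun l _ => ((h1 (p j - p l)).mul_right (y j)).mul_right (y l)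
  -- each term is nonnegative by H-d2 with `a := π/3 + πn ≤ b := 2π/3 + πn`
  refine hS.nonneg fun n => h2 _ _ (by positivity) ?_ M p y
  nlinarith [Real.pi_pos]

end Summit.CriticalPhenomena.CardyFormulaZ2.Cruxes.StripClusterRates.TwoClusterRateIsStationaryGap

end
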